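import Literature.AlgebraicGeometry.Motives.AbelianVarietyEndAlgebraSemisimpleProofs
import Literature.AlgebraicGeometry.Motives.FaltingsAbelianIsogenyProofs
import HarnessLib

/-!
# Faltings 1983, §5 over a number field, from Finiteness I and Mumford's §19 statements

A further pure-proof sibling of `Literature.AlgebraicGeometry.Motives.FaltingsAbelian` (with
`FaltingsAbelianProofs`, `FaltingsAbelianSemisimpleProofs`, `FaltingsAbelianEndAlgebraProofs`,
`FaltingsAbelianLatticeProofs`, `FaltingsAbelianIsogenyProofs`). Those files reduce Faltings' §5 —
Satz 3 (`isSemisimpleRepresentation_rationalTateRep`), Satz 4 (`faltings_tate_bijective A A ℓ`),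
Korollar 1 (`faltings_tate_bijective A B ℓ`), Korollar 2 (`isIsogenous_iff_nonempty_equiv_rationalTateRep`)
— to Finiteness I (`AbelianVariety.finite_isoClasses_isogenous`, Faltings §6 Satz 6 with Zarhin's
trick), quotients by finite stable subgroups (`AbelianVariety.exists_quotient_isogeny`, Mumford §7
Thm. 4) and three inputs from Mumford §19: `End_K(A)` finitely generated
(`AbelianVariety.module_finite_hom`, §19 Thm. 3), hence `End⁰(A)` finite-dimensional and the Tate
map injective, and `End⁰(A)` semisimple (§19 Cor. 2 of Thm. 1). Meanwhile the tree proves the two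
§19 inputs from Mumford's printed statements:
`AbelianVariety.module_finite_hom_of_mumford19_of_charZero` (`AVIsogenyTateHomPoincareProofs`) and
`AbelianVariety.isSemisimpleRing_endAlgebra_of_mumford19` (`AbelianVarietyEndAlgebraSemisimpleProofs`),
and `tate_end_bijective_of_finite_of_mumford19` assembles Tate's finite-field theorem that way.

This file is the number-field counterpart of that assembly: Satz 3, Satz 4, Korollar 1 and
Korollar 2 from exactly
* the named facts `finite_isoClasses_isogenous` (Finiteness I), `exists_quotient_isogeny`
  (quotients) and `natCard_torsionPoints_of_isAlgClosed` (`#A[n](K̄) = n^{2 dim A}`, Mumford §6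
  Prop. p. 64), for the abelian varieties named in each statement, and
* Mumford §19 as printed, entering as hypotheses spelled exactly as in
  `module_finite_hom_of_mumford19` / `tate_end_bijective_of_finite_of_mumford19`: Poincaré's
  complete reducibility theorem `hP1` (§19 Thm. 1, p. 173), "a non-zero homomorphism of simple
  abelian varieties is an isogeny" `hsimple` (§19, proof of Cor. 2 of Thm. 1, p. 174) and the
  degree theorem for simple abelian varieties `hdeg` (§19 Thm. 2).
Over a number field `char K = 0`, so `[n]_X` is an isogeny unconditionally
(`isIsogeny_zsmul_id_holds_of_charZero`) and the `h₀` input of the finite-field assembly is absent.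

So Satz 4, `faltings_tate_bijective A A ℓ`, is `faltings_tate_end_bijective_of_finitenessI_of_mumford19`
applied to `finite_isoClasses_isogenous_holds (A ⊞ A)`, `exists_quotient_isogeny_holds (A ⊞ A) ℓ`,
`natCard_torsionPoints_of_isAlgClosed_holds` and proofs of the three §19 statements — none of
which the tree has (Finiteness I is Faltings' theorem proper).

## Contents (theorems only; no definition, no named fact, D-0026)

* `AbelianVariety.module_finite_end_biprod_of_module_finite_hom`: `End(A ⊞ B)` is finitely
  generated as soon as `Hom(A, A)`, `Hom(A, B)`, `Hom(B, A)`, `Hom(B, B)` are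
  (`End(A × B) = End A ⊕ Hom(A, B) ⊕ Hom(B, A) ⊕ End B`; converse direction of the tree's
  `module_finite_hom_of_module_finite_end_biprod`).
* `faltings_tate_end_bijective_of_finitenessI_of_mumford19` (Satz 4),
  `faltings_tate_bijective_of_finitenessI_of_mumford19` (Korollar 1),
  `isSemisimpleRepresentation_rationalTateRep_of_finitenessI_of_mumford19` (Satz 3),
  `isIsogenous_iff_nonempty_equiv_rationalTateRep_of_finitenessI_of_mumford19` (Korollar 2,
  (i) ⇔ (ii)), `faltings_tate_bijective_of_forall_finitenessI_of_mumford19` (Korollar 1 for all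
  pairs from the global forms of the facts).

## References

* [Faltings1983Endlichkeit] G. Faltings, *Endlichkeitssätze für abelsche Varietäten über
  Zahlkörpern*, Invent. Math. 73 (1983), 349–366, §5: Satz 3, Satz 4, Korollar 1, Korollar 2;
  English translation [Faltings1986FinitenessTranslation] in Cornell–Silverman (1986), Ch. II §5,
  Theorems 3–4 and Corollaries 1–2 (held: `book:cornellnd-arithmetic-geometry`, PDF pp. 89–90:
  "By Theorems 1 and 2 … infinitely many of the A/G_n are isomorphic … as in [16]").
* [MumfordAV1970] D. Mumford, *Abelian Varieties* (1970), §19: Thm. 1 (p. 173), Cor. 2 of Thm. 1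
  (p. 174), Thm. 2, Thm. 3 (p. 176); §7 Thm. 4; §6 Prop. p. 64.
* [Milne1986AbelianVarieties] J. S. Milne, *Abelian Varieties*, in Cornell–Silverman (1986),
  Prop. 12.1, Thm. 12.5.
* [Kieffer2024IsogenyGraphs] J. Kieffer, *Isogeny graphs of abelian varieties over finite fields*
  (lecture notes, v1.0, 2024), §1.2, proof of Prop. 1.2.7, p. 22
  (`End(A × B) = End(A) ⊕ Hom(A, B) ⊕ Hom(B, A) ⊕ End(B)`; held, read).

## Design

Theorems only; `noncomputable section`; universe-monomorphic `K : Type u`. The named facts of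
`FaltingsAbelian` quantify `[NumberField K]` in their bodies (`∀ [NumberField K], …`); each
assembly first introduces that instance (`intro hK`), so that `CharZero K` is available to
`module_finite_hom_of_mumford19_of_charZero`, and the instance binder in the conclusion of the
`…_of_endAlgebra_of_module_finite_hom` combinators is then discharged by instance resolution.
-/

noncomputable section

universe u

open CategoryTheory CategoryTheory.Limits AlgebraicGeometry

namespace Literature.AlgebraicGeometry.Motives

/-! ## `End(A ⊞ B)` from the four `Hom` groups -/

namespace AbelianVariety

variable {K : Type u} [Field K] {A B : AbelianVariety K}

/-- **`End(A ⊞ B)` is finitely generated as soon as `Hom(A, A)`, `Hom(A, B)`, `Hom(B, A)` and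
`Hom(B, B)` are.** The additive map `f ↦ (in₁ f pr₁, in₁ f pr₂, in₂ f pr₁, in₂ f pr₂)`,
`End(A ⊞ B) → Hom(A, A) × Hom(A, B) × Hom(B, A) × Hom(B, B)`, is injective (a morphism out of and
into a binary biproduct is determined by its four components, Mathlib `biprod.hom_ext`,
`biprod.hom_ext'`), and `ℤ` is noetherian. This is the decomposition
`End(A × B) = End A ⊕ Hom(A, B) ⊕ Hom(B, A) ⊕ End B` (Kieffer, §1.2, proof of Prop. 1.2.7,
p. 22, after Mumford §19, proof of Thm. 3, p. 176), of which only injectivity is needed.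
[cite: Kieffer2024IsogenyGraphs, §1.2 proof of Prop. 1.2.7 (p. 22)] -/
theorem module_finite_end_biprod_of_module_finite_hom
    (hAA : Module.Finite ℤ (A ⟶ A)) (hAB : Module.Finite ℤ (A ⟶ B))
    (hBA : Module.Finite ℤ (B ⟶ A)) (hBB : Module.Finite ℤ (B ⟶ B)) :
    Module.Finite ℤ (A ⊞ B ⟶ A ⊞ B) := by
  let φ : (A ⊞ B ⟶ A ⊞ B) →ₗ[ℤ] ((A ⟶ A) × (A ⟶ B)) × ((B ⟶ A) × (B ⟶ B)) :=
    { toFun := fun f ↦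
        (((biprod.inl : A ⟶ A ⊞ B) ≫ f ≫ (biprod.fst : A ⊞ B ⟶ A),
          (biprod.inl : A ⟶ A ⊞ B) ≫ f ≫ (biprod.snd : A ⊞ B ⟶ B)),
         ((biprod.inr : B ⟶ A ⊞ B) ≫ f ≫ (biprod.fst : A ⊞ B ⟶ A),
          (biprod.inr : B ⟶ A ⊞ B) ≫ f ≫ (biprod.snd : A ⊞ B ⟶ B)))
      map_add' := fun f g ↦ by
        simp only [Preadditive.add_comp, Preadditive.comp_add, Prod.mk_add_mk]
      map_smul' := fun n f ↦ by
        simp only [Preadditive.zsmul_comp, Preadditive.comp_zsmul, RingHom.id_apply,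
          Prod.smul_mk] }
  have hφ : Function.Injective φ := fun f g hfg ↦ by
    change (((biprod.inl : A ⟶ A ⊞ B) ≫ f ≫ (biprod.fst : A ⊞ B ⟶ A),
          (biprod.inl : A ⟶ A ⊞ B) ≫ f ≫ (biprod.snd : A ⊞ B ⟶ B)),
         ((biprod.inr : B ⟶ A ⊞ B) ≫ f ≫ (biprod.fst : A ⊞ B ⟶ A),
          (biprod.inr : B ⟶ A ⊞ B) ≫ f ≫ (biprod.snd : A ⊞ B ⟶ B))) =
        (((biprod.inl : A ⟶ A ⊞ B) ≫ g ≫ (biprod.fst : A ⊞ B ⟶ A),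
          (biprod.inl : A ⟶ A ⊞ B) ≫ g ≫ (biprod.snd : A ⊞ B ⟶ B)),
         ((biprod.inr : B ⟶ A ⊞ B) ≫ g ≫ (biprod.fst : A ⊞ B ⟶ A),
          (biprod.inr : B ⟶ A ⊞ B) ≫ g ≫ (biprod.snd : A ⊞ B ⟶ B))) at hfg
    simp only [Prod.mk.injEq] at hfg
    obtain ⟨⟨h₁₁, h₁₂⟩, h₂₁, h₂₂⟩ := hfg
    refine biprod.hom_ext' _ _ (biprod.hom_ext _ _ ?_ ?_) (biprod.hom_ext _ _ ?_ ?_) <;>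
      simpa only [Category.assoc]
  haveI := hAA; haveI := hAB; haveI := hBA; haveI := hBB
  exact Module.Finite.of_injective φ hφ

end AbelianVariety

/-! ## Faltings §5 from Finiteness I, quotients, torsion counts and Mumford §19 as printed -/

section Assembly

open AbelianVariety

variable {K : Type u} [Field K] (A B : AbelianVariety K) (ℓ : ℕ) [Fact ℓ.Prime]

open scoped Classical in
/-- **Faltings 1983, §5, Satz 4, from Finiteness I and Mumford's statements.** For an abelian
variety `A` over a number field `K` and a prime `ℓ`, the Tate map
`ℤ_ℓ ⊗ End_K(A) → End_{Γ_K}(T_ℓ A)` is bijective (`faltings_tate_bijective A A ℓ`), granted: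
Finiteness I for `A ⊞ A` (`hfin`, named fact `finite_isoClasses_isogenous`: up to isomorphism
only finitely many abelian varieties over `K` are isogenous to `A ⊞ A` — Faltings §6 Satz 6 with
Zarhin's trick), quotients of `A ⊞ A` by finite `Γ_K`-stable subgroups (`hq`, named fact
`exists_quotient_isogeny`, Mumford §7 Thm. 4), the torsion count `#A[n](K̄) = n ^ (2 dim A)`
(`hA`, named fact `natCard_torsionPoints_of_isAlgClosed`, Mumford §6 Prop. p. 64), and Mumford
§19 as printed: Poincaré's complete reducibility theorem (`hP1`, Thm. 1 p. 173), "a non-zero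
homomorphism of simple abelian varieties is an isogeny" (`hsimple`, proof of Cor. 2 p. 174) and
the degree theorem for simple abelian varieties (`hdeg`, Thm. 2). Proof: `char K = 0`, so
`End_K(A)` is finitely generated by `module_finite_hom_of_mumford19_of_charZero` (§19 Thm. 3) and
`End⁰(A)` is semisimple by `isSemisimpleRing_endAlgebra_of_mumford19` (§19 Cor. 2 of Thm. 1);
conclude by `faltings_tate_end_bijective_of_finitenessI_of_endAlgebra_of_module_finite_hom`
(Faltings' printed argument: Theorems 1–2 ⇒ the lattice lemma ⇒ Tate's argument "as in [16]").
[cite: Faltings1983Endlichkeit, §5 Satz 4] -/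
theorem faltings_tate_end_bijective_of_finitenessI_of_mumford19
    (hfin : finite_isoClasses_isogenous (A ⊞ A)) (hq : exists_quotient_isogeny (A ⊞ A) ℓ)
    (hP1 : ∀ (X Y : AbelianVariety K) (i : Y ⟶ X), IsClosedImmersion (Hom.toSchemeHom i) →
      0 < Y.dim → Y.dim < X.dim →
      ∃ (Z : AbelianVariety K) (j : Z ⟶ X), IsClosedImmersion (Hom.toSchemeHom j) ∧
        IsIsogeny (biprod.desc i j))
    (hsimple : ∀ (X Y : AbelianVariety K), IsSimple X → IsSimple Y →
      ∀ f : X ⟶ Y, f ≠ 0 → IsIsogeny f)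
    (hdeg : ∀ X : AbelianVariety K, IsSimple X → 0 < X.dim →
      ∀ (r : ℕ) (e : Fin r → (X ⟶ X)), ∃ F : MvPolynomial (Fin r) ℚ,
        (∀ (t : ℚ) (q : Fin r → ℚ), MvPolynomial.eval (t • q) F =
          t ^ (2 * X.dim) * MvPolynomial.eval q F) ∧
        ∀ n : Fin r → ℤ,
          ((if IsIsogeny (∑ i, n i • e i) then (Hom.kerRank (∑ i, n i • e i) : ℤ) else 0 : ℤ) : ℚ) =
            MvPolynomial.eval (fun i => (n i : ℚ)) F)
    (hA : A.natCard_torsionPoints_of_isAlgClosed (AlgebraicClosure K)) :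
    faltings_tate_bijective A A ℓ := by
  intro hK
  have h := faltings_tate_end_bijective_of_finitenessI_of_endAlgebra_of_module_finite_hom A ℓ hfin
    hq (isSemisimpleRing_endAlgebra_of_mumford19 hP1 hsimple A)
    (module_finite_hom_of_mumford19_of_charZero hP1 hsimple hdeg A A hA hA)
  exact h

open scoped Classical in
/-- **Faltings 1983, §5, Korollar 1, from Finiteness I and Mumford's statements** ("Theorem 4
applied to `A₁ × A₂`"): for abelian varieties `A`, `B` over a number field the Tate map
`ℤ_ℓ ⊗ Hom_K(A, B) → Hom_{Γ_K}(T_ℓ A, T_ℓ B)` is bijective (`faltings_tate_bijective A B ℓ`),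
granted Finiteness I and quotients for `(A ⊞ B) ⊞ (A ⊞ B)`, the torsion counts of `A` and `B`,
and Mumford §19 as printed (`hP1`, `hsimple`, `hdeg`, as in
`faltings_tate_end_bijective_of_finitenessI_of_mumford19`). The four groups `Hom(A, A)`,
`Hom(A, B)`, `Hom(B, A)`, `Hom(B, B)` are finitely generated
(`module_finite_hom_of_mumford19_of_charZero`), hence so is `End(A ⊞ B)`
(`module_finite_end_biprod_of_module_finite_hom`); Satz 4 for `A ⊞ B`
(`faltings_tate_end_bijective_of_finitenessI_of_endAlgebra_of_module_finite_hom` with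
`isSemisimpleRing_endAlgebra_of_mumford19`) restricts to the corner `Hom(A, B)`
(`faltings_tate_bijective_of_end_biprod`). [cite: Faltings1983Endlichkeit, §5 Korollar 1] -/
theorem faltings_tate_bijective_of_finitenessI_of_mumford19
    (hfin : finite_isoClasses_isogenous ((A ⊞ B) ⊞ (A ⊞ B)))
    (hq : exists_quotient_isogeny ((A ⊞ B) ⊞ (A ⊞ B)) ℓ)
    (hP1 : ∀ (X Y : AbelianVariety K) (i : Y ⟶ X), IsClosedImmersion (Hom.toSchemeHom i) →
      0 < Y.dim → Y.dim < X.dim →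
      ∃ (Z : AbelianVariety K) (j : Z ⟶ X), IsClosedImmersion (Hom.toSchemeHom j) ∧
        IsIsogeny (biprod.desc i j))
    (hsimple : ∀ (X Y : AbelianVariety K), IsSimple X → IsSimple Y →
      ∀ f : X ⟶ Y, f ≠ 0 → IsIsogeny f)
    (hdeg : ∀ X : AbelianVariety K, IsSimple X → 0 < X.dim →
      ∀ (r : ℕ) (e : Fin r → (X ⟶ X)), ∃ F : MvPolynomial (Fin r) ℚ,
        (∀ (t : ℚ) (q : Fin r → ℚ), MvPolynomial.eval (t • q) F =
          t ^ (2 * X.dim) * MvPolynomial.eval q F) ∧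
        ∀ n : Fin r → ℤ,
          ((if IsIsogeny (∑ i, n i • e i) then (Hom.kerRank (∑ i, n i • e i) : ℤ) else 0 : ℤ) : ℚ) =
            MvPolynomial.eval (fun i => (n i : ℚ)) F)
    (hA : A.natCard_torsionPoints_of_isAlgClosed (AlgebraicClosure K))
    (hB : B.natCard_torsionPoints_of_isAlgClosed (AlgebraicClosure K)) :
    faltings_tate_bijective A B ℓ := by
  intro hK
  have hfg : module_finite_hom (A ⊞ B) (A ⊞ B) :=
    module_finite_end_biprod_of_module_finite_hom
      (module_finite_hom_of_mumford19_of_charZero hP1 hsimple hdeg A A hA hA)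
      (module_finite_hom_of_mumford19_of_charZero hP1 hsimple hdeg A B hA hB)
      (module_finite_hom_of_mumford19_of_charZero hP1 hsimple hdeg B A hB hA)
      (module_finite_hom_of_mumford19_of_charZero hP1 hsimple hdeg B B hB hB)
  have h := faltings_tate_bijective_of_end_biprod A B ℓ
    (faltings_tate_end_bijective_of_finitenessI_of_endAlgebra_of_module_finite_hom (A ⊞ B) ℓ hfin
      hq (isSemisimpleRing_endAlgebra_of_mumford19 hP1 hsimple (A ⊞ B)) hfg)
  exact h

open scoped Classical in
/-- **Faltings 1983, §5, Satz 3, from Finiteness I and Mumford's statements**: over a number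
field the rational Tate module `V_ℓ A` is a semisimple `ℚ_ℓ[Γ_K]`-module
(`isSemisimpleRepresentation_rationalTateRep A ℓ`), granted Finiteness I and quotients for `A`,
the torsion count of `A`, and Mumford §19 as printed (`hP1`, `hsimple`, `hdeg`): `End_K(A)` is
finitely generated (`module_finite_hom_of_mumford19_of_charZero`), so `End⁰(A)` is
finite-dimensional (`finiteDimensional_endAlgebra_of_module_finite_hom`) and semisimple
(`isSemisimpleRing_endAlgebra_of_mumford19`); conclude by
`isSemisimpleRepresentation_rationalTateRep_of_finitenessI_of_endAlgebra` (Faltings' printed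
argument: `W` stable, `u_n` from the lattice lemma, `u = lim u_{n_i}`, right ideal `u E` generated
by an idempotent of the semisimple algebra `E ⊗ ℚ_ℓ`). [cite: Faltings1983Endlichkeit, §5 Satz 3] -/
theorem isSemisimpleRepresentation_rationalTateRep_of_finitenessI_of_mumford19
    (hfin : finite_isoClasses_isogenous A) (hq : exists_quotient_isogeny A ℓ)
    (hP1 : ∀ (X Y : AbelianVariety K) (i : Y ⟶ X), IsClosedImmersion (Hom.toSchemeHom i) →
      0 < Y.dim → Y.dim < X.dim →
      ∃ (Z : AbelianVariety K) (j : Z ⟶ X), IsClosedImmersion (Hom.toSchemeHom j) ∧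
        IsIsogeny (biprod.desc i j))
    (hsimple : ∀ (X Y : AbelianVariety K), IsSimple X → IsSimple Y →
      ∀ f : X ⟶ Y, f ≠ 0 → IsIsogeny f)
    (hdeg : ∀ X : AbelianVariety K, IsSimple X → 0 < X.dim →
      ∀ (r : ℕ) (e : Fin r → (X ⟶ X)), ∃ F : MvPolynomial (Fin r) ℚ,
        (∀ (t : ℚ) (q : Fin r → ℚ), MvPolynomial.eval (t • q) F =
          t ^ (2 * X.dim) * MvPolynomial.eval q F) ∧
        ∀ n : Fin r → ℤ,
          ((if IsIsogeny (∑ i, n i • e i) then (Hom.kerRank (∑ i, n i • e i) : ℤ) else 0 : ℤ) : ℚ) =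
            MvPolynomial.eval (fun i => (n i : ℚ)) F)
    (hA : A.natCard_torsionPoints_of_isAlgClosed (AlgebraicClosure K)) :
    isSemisimpleRepresentation_rationalTateRep A ℓ := by
  intro hK
  have hfg : module_finite_hom A A :=
    module_finite_hom_of_mumford19_of_charZero hP1 hsimple hdeg A A hA hA
  have h := isSemisimpleRepresentation_rationalTateRep_of_finitenessI_of_endAlgebra A ℓ hfin hq
    (finiteDimensional_endAlgebra_of_module_finite_hom A hfg)
    (isSemisimpleRing_endAlgebra_of_mumford19 hP1 hsimple A)
  exact h

open scoped Classical in
/-- **Faltings 1983, §5, Korollar 1 for all pairs, from the global forms of the inputs**: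
Finiteness I and quotients for every abelian variety over the number field `K`, the torsion
counts, and Mumford §19 as printed give the bijectivity of the Tate map for every pair `(X, Y)`
(`faltings_tate_bijective_of_finitenessI_of_mumford19`). [cite: Faltings1983Endlichkeit, §5 Korollar 1] -/
theorem faltings_tate_bijective_of_forall_finitenessI_of_mumford19
    (hfin : ∀ P : AbelianVariety K, finite_isoClasses_isogenous P)
    (hq : ∀ P : AbelianVariety K, exists_quotient_isogeny P ℓ)
    (hP1 : ∀ (X Y : AbelianVariety K) (i : Y ⟶ X), IsClosedImmersion (Hom.toSchemeHom i) →
      0 < Y.dim → Y.dim < X.dim →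
      ∃ (Z : AbelianVariety K) (j : Z ⟶ X), IsClosedImmersion (Hom.toSchemeHom j) ∧
        IsIsogeny (biprod.desc i j))
    (hsimple : ∀ (X Y : AbelianVariety K), IsSimple X → IsSimple Y →
      ∀ f : X ⟶ Y, f ≠ 0 → IsIsogeny f)
    (hdeg : ∀ X : AbelianVariety K, IsSimple X → 0 < X.dim →
      ∀ (r : ℕ) (e : Fin r → (X ⟶ X)), ∃ F : MvPolynomial (Fin r) ℚ,
        (∀ (t : ℚ) (q : Fin r → ℚ), MvPolynomial.eval (t • q) F =
          t ^ (2 * X.dim) * MvPolynomial.eval q F) ∧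
        ∀ n : Fin r → ℤ,
          ((if IsIsogeny (∑ i, n i • e i) then (Hom.kerRank (∑ i, n i • e i) : ℤ) else 0 : ℤ) : ℚ) =
            MvPolynomial.eval (fun i => (n i : ℚ)) F)
    (hcard : ∀ P : AbelianVariety K, P.natCard_torsionPoints_of_isAlgClosed (AlgebraicClosure K))
    (X Y : AbelianVariety K) : faltings_tate_bijective X Y ℓ :=
  faltings_tate_bijective_of_finitenessI_of_mumford19 X Y ℓ (hfin _) (hq _) hP1 hsimple hdeg
    (hcard X) (hcard Y)

open scoped Classical in
/-- **Faltings 1983, §5, Korollar 2, (i) ⇔ (ii), from Finiteness I and Mumford's statements**: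
two abelian varieties `A`, `B` over a number field are `K`-isogenous iff `V_ℓ A ≅ V_ℓ B` as
`ℚ_ℓ[Γ_K]`-modules (`isIsogenous_iff_nonempty_equiv_rationalTateRep A B ℓ`), granted Finiteness I
and quotients for every abelian variety over `K`, the torsion counts, and Mumford §19 as printed:
Korollar 1 for the pairs `(A, B)`, `(B, A)`, `(A, A)`, `(B, B)`
(`faltings_tate_bijective_of_forall_finitenessI_of_mumford19`) and the tree's deduction of
Korollar 2 from Korollar 1
(`isIsogenous_iff_nonempty_equiv_rationalTateRep_of_forall_faltings_tate_bijective`, "the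
equivalence of (i) and (ii) follows from Theorem 4"). [cite: Faltings1983Endlichkeit, §5 Korollar 2] -/
theorem isIsogenous_iff_nonempty_equiv_rationalTateRep_of_finitenessI_of_mumford19
    (hfin : ∀ P : AbelianVariety K, finite_isoClasses_isogenous P)
    (hq : ∀ P : AbelianVariety K, exists_quotient_isogeny P ℓ)
    (hP1 : ∀ (X Y : AbelianVariety K) (i : Y ⟶ X), IsClosedImmersion (Hom.toSchemeHom i) →
      0 < Y.dim → Y.dim < X.dim →
      ∃ (Z : AbelianVariety K) (j : Z ⟶ X), IsClosedImmersion (Hom.toSchemeHom j) ∧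
        IsIsogeny (biprod.desc i j))
    (hsimple : ∀ (X Y : AbelianVariety K), IsSimple X → IsSimple Y →
      ∀ f : X ⟶ Y, f ≠ 0 → IsIsogeny f)
    (hdeg : ∀ X : AbelianVariety K, IsSimple X → 0 < X.dim →
      ∀ (r : ℕ) (e : Fin r → (X ⟶ X)), ∃ F : MvPolynomial (Fin r) ℚ,
        (∀ (t : ℚ) (q : Fin r → ℚ), MvPolynomial.eval (t • q) F =
          t ^ (2 * X.dim) * MvPolynomial.eval q F) ∧
        ∀ n : Fin r → ℤ,
          ((if IsIsogeny (∑ i, n i • e i) then (Hom.kerRank (∑ i, n i • e i) : ℤ) else 0 : ℤ) : ℚ) =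
            MvPolynomial.eval (fun i => (n i : ℚ)) F)
    (hcard : ∀ P : AbelianVariety K, P.natCard_torsionPoints_of_isAlgClosed (AlgebraicClosure K)) :
    isIsogenous_iff_nonempty_equiv_rationalTateRep A B ℓ :=
  isIsogenous_iff_nonempty_equiv_rationalTateRep_of_forall_faltings_tate_bijective A B ℓ
    (faltings_tate_bijective_of_forall_finitenessI_of_mumford19 ℓ hfin hq hP1 hsimple hdeg hcard)

end Assembly

end Literature.AlgebraicGeometry.Motives
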